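import Summits.CriticalPhenomena.PercolationContinuityZ3.Theorems.PercNearOneGluingNoHeavyQuantMonoHubPairing
import HarnessLib

/-!
# QUANT lane R8, FAR on trees: the profile conjecture for MONOTONE hub laws, II — the cases 'no block' and 'one root block'
# (every size, every gate), and FAR for 'hub + leaves + one root block' with the AVERAGE leaf gate

builds on p205010 (kernel theorem, internal audit signed; external expert review pending)

Support file (`--supports stmt-CriticalPhenomena-4575`), QUANT lane typer seat prim-quant-stmt (gen 13); memo
`run/shared/lean/prim/quant/prim-quant-stmt-g13/MONO-RELAXATION.md`; Part I is `…QuantMonoHubPairing.lean` (`Quant.reflect_pairing`,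
`Quant.mono_profile_oneLightBlock`).  Theorems only; no definitions, no sorries, standard axioms.

* `Quant.hubBlocksProfileIneq_mono_empty`, `Quant.hubBlocksProfileIneq_mono_singleton` — **the profile conjecture `Quant.HubBlocksProfileIneq`
  for `K = ∅` and for `K = {x}` (any size, any gate), for every hub law that is monotone below the mean** (hence for every ratio-regular one,
  `Quant.mono_of_ratioRegular`), in the exact binder shape of the conjecture.  Heavy block (`size x ≥ j+1`): every level is worth `≥ q x/G ≥ τ`;
  light block: `Quant.mono_profile_oneLightBlock` with `M = μ/τ`, `g = q x`, `a = size x`.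
* `Quant.farTree_hubBlock_avgGate` — consequence through the unconditional reduction `Quant.farTree_hubBlocks_of_profile`: FAR at every layer
  for 'hub (any gate) + leaf relays (any gates, glued hub relays = gate-1 leaves) + ONE root block (any size, any gate)' with the cuts
  `1 − q b ≤ t` and `1 − q h·(Σ_L q)/|L| ≤ t` — the AVERAGE leaf gate (gen 10's `Quant.farTree_hubBlock` has the least leaf gate and is thereby
  re-proved without 'atom beats tail' / Cantelli).
[cite: KozmaNitzan2024, Conjecture 3 (p. 15)] (the gluing rows served); the inequalities are [this work].
-/

noncomputable section

namespace Summit.CriticalPhenomena.PercolationContinuityZ3.Theorems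

namespace Quant

open Finset MeasureTheory
open Literature.Probability.LatticeModels
open Literature.Probability.Percolation
open scoped Classical

variable {n : ℕ}

/-! ### 5. The profile conjecture for `K = ∅` and `K = {x}`, monotone hub laws -/

/-- **Profile conjecture, no root block, monotone hub law.**  In the binder shape of `Quant.HubBlocksProfileIneq` with `K = ∅` and the
hypothesis 'ratio-regular' weakened to 'nondecreasing below the mean': `2j < G·μ`, `τ ≤ μ/m` give `τ ≤ Σ_b p b·(P(W ≥ j+1−b) + ρ·P(W ≥ j+1))`
(`W ≡ 0`, so this is `τ ≤ P_p(Y ≥ j+1)`: the average-gate star row for monotone laws). [this work] -/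
theorem hubBlocksProfileIneq_mono_empty (q : Fin n → unitInterval) (size : Fin n → ℕ) (m : ℕ) (p : ℕ → ℝ)
    (μ G τ : ℝ) (j : ℕ)
    (hp0 : ∀ b, 0 ≤ p b) (hsum : ∑ b ∈ Finset.range (m + 1), p b = 1)
    (hmean : ∑ b ∈ Finset.range (m + 1), (b : ℝ) * p b = μ) (hμ : 0 < μ)
    (hmono : ∀ b : ℕ, 1 ≤ b → (b : ℝ) ≤ μ → p (b - 1) ≤ p b)
    (_hG0 : 0 < G) (hG1 : G ≤ 1)
    (hEN : (2 * j : ℝ) < (∑ x ∈ (∅ : Finset (Fin n)), (size x : ℝ) * (q x : ℝ)) + G * μ)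
    (hτ : τ ≤ μ / m) :
    τ ≤ ∑ b ∈ Finset.range (m + 1), p b *
      ((prodBernoulli q).real {ω : Set (Fin n) | j + 1 - b ≤ ∑ x ∈ (∅ : Finset (Fin n)).filter (fun x => x ∈ ω), size x} +
        (1 - G) / G * (prodBernoulli q).real {ω : Set (Fin n) | j + 1 ≤ ∑ x ∈ (∅ : Finset (Fin n)).filter (fun x => x ∈ ω), size x}) := by
  -- the `W`-events for `K = ∅`
  have hW : ∀ i : ℕ, (prodBernoulli q).real {ω : Set (Fin n) | i ≤ ∑ x ∈ (∅ : Finset (Fin n)).filter (fun x => x ∈ ω), size x} =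
      if i = 0 then 1 else 0 := by
    intro i
    simp only [Finset.filter_empty, Finset.sum_empty, nonpos_iff_eq_zero]
    split_ifs with h
    · have : {ω : Set (Fin n) | i = 0} = Set.univ := by ext; simp [h]
      rw [this, probReal_univ]
    · have : {ω : Set (Fin n) | i = 0} = ∅ := by ext; simp [h]
      rw [this, measureReal_empty]
  simp only [hW, Finset.sum_empty, zero_add] at hEN ⊢
  have hj0 : ¬ (j + 1 = 0) := by omega
  simp only [hj0, if_false, mul_zero, add_zero]
  -- now the claim is `τ ≤ Σ_b p b · 1[j+1−b = 0]`
  have hμm : μ ≤ m := mean_le_top p m μ hp0 hsum hmean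
  have hm0 : 0 < m := by
    by_contra h; push Not at h; interval_cases m; simp at hμm; linarith
  have hm0' : (0 : ℝ) < m := by exact_mod_cast hm0
  rcases le_or_gt τ 0 with hτ0 | hτ0
  · exact hτ0.trans (Finset.sum_nonneg fun b _ => mul_nonneg (hp0 b) (by split_ifs <;> norm_num))
  -- apply the pure form with `a = 0`, `g = 1`, `M = μ/τ`
  set M : ℝ := μ / τ with hMdef
  have hMm : (m : ℝ) ≤ M := by
    rw [hMdef, le_div_iff₀ hτ0]
    calc (m : ℝ) * τ ≤ m * (μ / m) := mul_le_mul_of_nonneg_left hτ (Nat.cast_nonneg m)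
      _ = μ := by field_simp
  have h2j : (2 * j : ℝ) < μ := by nlinarith
  have hmono' : ∀ b b' : ℕ, 1 ≤ b → b ≤ b' → b' ≤ 2 * j - 0 → p b ≤ p b' := by
    intro b b' hb hbb' hb'
    have hb'' : b' ≤ 2 * j := by omega
    refine mono_chain p μ hmono hbb' ?_
    have : (b' : ℝ) ≤ 2 * j := by exact_mod_cast hb''
    linarith
  have hm' : 2 * j - 0 + 1 ≤ m := by
    have h1 : (2 * j : ℝ) < m := h2j.trans_le hμm
    have h2 : 2 * j < m := by exact_mod_cast h1
    omega
  have hMg : (j : ℝ) ≤ M * 1 := by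
    have : (j : ℝ) ≤ 2 * j := by linarith [(Nat.cast_nonneg j : (0 : ℝ) ≤ j)]
    linarith
  have key := mono_profile_oneLightBlock p m j 0 M 1 (Nat.zero_le _) hp0 hmono' hm' hMm hMg
  rw [hmean] at key
  -- simplify the window indicator (`j − 0 < b ∧ b ≤ j` is empty) and compare
  have e : ∑ b ∈ Finset.range (m + 1), p b * ((if j < b then (1 : ℝ) else 0) + 1 * (if j - 0 < b ∧ b ≤ j then (1 : ℝ) else 0)) =
      ∑ b ∈ Finset.range (m + 1), p b * (if j + 1 - b = 0 then (1 : ℝ) else 0) := by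
    refine Finset.sum_congr rfl fun b _ => ?_
    by_cases hb : j < b
    · have c1 : j + 1 - b = 0 := by omega
      have c2 : ¬ (j - 0 < b ∧ b ≤ j) := by omega
      rw [if_pos hb, if_neg c2, if_pos c1]; ring
    · have c1 : ¬ (j + 1 - b = 0) := by omega
      have c2 : ¬ (j - 0 < b ∧ b ≤ j) := by omega
      rw [if_neg hb, if_neg c2, if_neg c1]; ring
  rw [e] at key
  -- `μ ≤ M · S` with `M = μ/τ`, `μ > 0`, `τ > 0` gives `τ ≤ S`
  have hS0 : 0 ≤ ∑ b ∈ Finset.range (m + 1), p b * (if j + 1 - b = 0 then (1 : ℝ) else 0) :=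
    Finset.sum_nonneg fun b _ => mul_nonneg (hp0 b) (by split_ifs <;> norm_num)
  rw [hMdef] at key
  have hτne : τ ≠ 0 := hτ0.ne'
  have : τ * μ ≤ μ * ∑ b ∈ Finset.range (m + 1), p b * (if j + 1 - b = 0 then (1 : ℝ) else 0) := by
    have := mul_le_mul_of_nonneg_left key hτ0.le
    calc τ * μ ≤ τ * (μ / τ * ∑ b ∈ Finset.range (m + 1), p b * (if j + 1 - b = 0 then (1 : ℝ) else 0)) := this
      _ = μ * ∑ b ∈ Finset.range (m + 1), p b * (if j + 1 - b = 0 then (1 : ℝ) else 0) := by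
        field_simp
  nlinarith

/-- **Profile conjecture, ONE root block (any size, any gate), monotone hub law.**  In the binder shape of `Quant.HubBlocksProfileIneq` with
`K = {x}` and 'ratio-regular' weakened to 'nondecreasing below the mean': if `2j < size x·q x + G·μ`, `τ ≤ μ/m` and `G·τ ≤ q x` then
`τ ≤ Σ_b p b·(P(W ≥ j+1−b) + ((1−G)/G)·P(W ≥ j+1))`, `W = size x·1[x ∈ ω]`.  Heavy block (`size x ≥ j+1`): every level has
`ℓ b ≥ q x/G ≥ τ`.  Light block: `Quant.mono_profile_oneLightBlock` with `M = μ/τ`, `g = q x`, `a = size x`. [this work] -/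
theorem hubBlocksProfileIneq_mono_singleton (q : Fin n → unitInterval) (x : Fin n) (size : Fin n → ℕ) (m : ℕ) (p : ℕ → ℝ)
    (μ G τ : ℝ) (j : ℕ)
    (hp0 : ∀ b, 0 ≤ p b) (hsum : ∑ b ∈ Finset.range (m + 1), p b = 1)
    (hmean : ∑ b ∈ Finset.range (m + 1), (b : ℝ) * p b = μ) (hμ : 0 < μ)
    (hmono : ∀ b : ℕ, 1 ≤ b → (b : ℝ) ≤ μ → p (b - 1) ≤ p b)
    (hG0 : 0 < G) (hG1 : G ≤ 1)
    (hEN : (2 * j : ℝ) < (∑ y ∈ ({x} : Finset (Fin n)), (size y : ℝ) * (q y : ℝ)) + G * μ)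
    (hτ : τ ≤ μ / m) (hτq : ∀ y ∈ ({x} : Finset (Fin n)), G * τ ≤ (q y : ℝ)) :
    τ ≤ ∑ b ∈ Finset.range (m + 1), p b *
      ((prodBernoulli q).real {ω : Set (Fin n) | j + 1 - b ≤ ∑ y ∈ ({x} : Finset (Fin n)).filter (fun y => y ∈ ω), size y} +
        (1 - G) / G * (prodBernoulli q).real {ω : Set (Fin n) | j + 1 ≤ ∑ y ∈ ({x} : Finset (Fin n)).filter (fun y => y ∈ ω), size y}) := by
  simp only [singleton_blockSum_real, Finset.sum_singleton] at hEN ⊢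
  have hqx := hτq x (Finset.mem_singleton_self x)
  set g : ℝ := (q x : ℝ) with hgdef
  set a : ℕ := size x with hadef
  have hg0 : 0 ≤ g := (q x).2.1
  have hg1 : g ≤ 1 := (q x).2.2
  have hρ0 : 0 ≤ (1 - G) / G := div_nonneg (by linarith) hG0.le
  have hμm : μ ≤ m := mean_le_top p m μ hp0 hsum hmean
  have hm0 : 0 < m := by
    by_contra h; push Not at h; interval_cases m; simp at hμm; linarith
  have hm0' : (0 : ℝ) < m := by exact_mod_cast hm0
  rcases le_or_gt τ 0 with hτ0 | hτ0
  · have hF0 : ∀ i : ℕ, 0 ≤ (if i = 0 then (1 : ℝ) else if i ≤ a then g else 0) := by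
      intro i; split_ifs; exacts [zero_le_one, hg0, le_rfl]
    exact hτ0.trans (Finset.sum_nonneg fun b _ => mul_nonneg (hp0 b) (add_nonneg (hF0 _) (mul_nonneg hρ0 (hF0 _))))
  have hj0 : ¬ (j + 1 = 0) := by omega
  simp only [hj0, if_false]
  by_cases hheavy : j + 1 ≤ a
  · -- heavy block: every level is worth at least `g + ρ g = g/G ≥ τ`
    simp only [hheavy, if_true]
    have hlev : ∀ b ∈ Finset.range (m + 1), p b * τ ≤
        p b * ((if j + 1 - b = 0 then (1 : ℝ) else if j + 1 - b ≤ a then g else 0) + (1 - G) / G * g) := by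
      intro b _
      refine mul_le_mul_of_nonneg_left ?_ (hp0 b)
      have hF : g ≤ (if j + 1 - b = 0 then (1 : ℝ) else if j + 1 - b ≤ a then g else 0) := by
        split_ifs with h1 h2
        · exact hg1
        · exact le_rfl
        · exfalso; omega
      have hgG : τ ≤ g + (1 - G) / G * g := by
        have e : g + (1 - G) / G * g = g / G := by field_simp; ring
        rw [e, le_div_iff₀ hG0]; linarith
      linarith [mul_nonneg hρ0 hg0]
    have := Finset.sum_le_sum hlev
    rw [← Finset.sum_mul, hsum, one_mul] at this
    exact this
  · -- light block
    push Not at hheavy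
    have haj : a ≤ j := by omega
    simp only [show ¬ (j + 1 ≤ a) by omega, if_false, mul_zero, add_zero]
    set M : ℝ := μ / τ with hMdef
    have hMm : (m : ℝ) ≤ M := by
      rw [hMdef, le_div_iff₀ hτ0]
      calc (m : ℝ) * τ ≤ m * (μ / m) := mul_le_mul_of_nonneg_left hτ (Nat.cast_nonneg m)
        _ = μ := by field_simp
    -- `M g ≥ G μ > 2j − a g ≥ j` and `μ > 2j − a`
    have hag : (a : ℝ) * g ≤ a := by nlinarith [(Nat.cast_nonneg a : (0 : ℝ) ≤ a)]
    have haj' : (a : ℝ) ≤ j := by exact_mod_cast haj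
    have hMg' : G * μ ≤ M * g := by
      rw [hMdef]
      have : G * τ * μ ≤ g * μ := mul_le_mul_of_nonneg_right hqx hμ.le
      have e : μ / τ * g = g * μ / τ := by ring
      rw [e, le_div_iff₀ hτ0]; linarith
    have hMg : (j : ℝ) ≤ M * g := by linarith
    have h2j : (2 * j : ℝ) - a < μ := by nlinarith
    have hmono' : ∀ b b' : ℕ, 1 ≤ b → b ≤ b' → b' ≤ 2 * j - a → p b ≤ p b' := by
      intro b b' hb hbb' hb'
      refine mono_chain p μ hmono hbb' ?_
      have h1 : b' + a ≤ 2 * j := by omega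
      have h2 : (b' : ℝ) + a ≤ 2 * j := by exact_mod_cast h1
      linarith
    have hm' : 2 * j - a + 1 ≤ m := by
      have h1 : (2 * j : ℝ) - a < m := h2j.trans_le hμm
      have h2 : (2 * j : ℝ) < m + a := by linarith
      have h3 : 2 * j < m + a := by exact_mod_cast h2
      omega
    have key := mono_profile_oneLightBlock p m j a M g haj hp0 hmono' hm' hMm hMg
    rw [hmean] at key
    -- identify the test function
    have e : ∑ b ∈ Finset.range (m + 1), p b * ((if j < b then (1 : ℝ) else 0) + g * (if j - a < b ∧ b ≤ j then (1 : ℝ) else 0)) =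
        ∑ b ∈ Finset.range (m + 1), p b * (if j + 1 - b = 0 then (1 : ℝ) else if j + 1 - b ≤ a then g else 0) := by
      refine Finset.sum_congr rfl fun b _ => ?_
      congr 1
      by_cases hb : j < b
      · have c1 : j + 1 - b = 0 := by omega
        have c2 : ¬ (j - a < b ∧ b ≤ j) := by omega
        simp [hb, c1, c2]
      · have c1 : ¬ (j + 1 - b = 0) := by omega
        by_cases hw : j - a < b ∧ b ≤ j
        · have c3 : j + 1 - b ≤ a := by omega
          simp [hb, c1, hw, c3]
        · have c3 : ¬ (j + 1 - b ≤ a) := by omega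
          simp [hb, c1, hw, c3]
    rw [e] at key
    set S := ∑ b ∈ Finset.range (m + 1), p b * (if j + 1 - b = 0 then (1 : ℝ) else if j + 1 - b ≤ a then g else 0) with hSdef
    rw [hMdef] at key
    have hτne : τ ≠ 0 := hτ0.ne'
    have : τ * μ ≤ μ * S := by
      have := mul_le_mul_of_nonneg_left key hτ0.le
      calc τ * μ ≤ τ * (μ / τ * S) := this
        _ = μ * S := by field_simp
    nlinarith

/-! ### 6. FAR for 'hub + leaves + ONE root block' with the average leaf gate -/

/-- **FAR at every layer for 'hub (any gate) + leaf relays (any gates) + ONE root block (any size, any gate)', average leaf gate.**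
Setting of `Quant.farTree_hubBlocks_of_profile` with `K = {b}`: observer `o`, hub `h`, leaf relays `L` (parent `h`), block vertex `b`
(parent `o`) with gate-`1` tail `B b`; relays `A = L ∪ {b} ∪ B b`.  If `2j < q h·Σ_{ℓ∈L} q ℓ + q b·(|B b|+1)` (`= Σ_{a∈A} P(a reached)`),
`1 − q b ≤ t` and `1 − q h·(Σ_{ℓ∈L} q ℓ)/|L| ≤ t` (the AVERAGE leaf gate), then `P(#{a ∈ A counted} ≤ j) ≤ t`.  Via
`Quant.hubBlocksProfileIneq_mono_singleton`, `Quant.pb_pmf_mono_succ` (the leaf count is monotone below its mean), `Quant.pb_mean`,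
`Quant.pb_levels_sum_one`, `Quant.farTree_hubBlocks_of_profile`. [this work] -/
theorem farTree_hubBlock_avgGate (q : Fin n → unitInterval) (o h b : Fin n)
    (L : Finset (Fin n)) (B : Fin n → Finset (Fin n)) (depth : Fin n → ℕ) (par : Fin n → Fin n) (j : ℕ) (t : ℝ)
    (hK : par b = o ∧ depth b = 0)
    (hL : ∀ a ∈ L, par a = h ∧ depth a = 1) (hB : ∀ a ∈ B b, par a = b ∧ depth a = 1)
    (hhL : h ∉ L) (hhb : h ≠ b) (hbL : b ∉ L) (hLB : Disjoint L (B b)) (hbB : b ∉ B b)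
    (hqB : ∀ a ∈ B b, q a = 1) (hL0 : L.Nonempty)
    (hEN : (2 * j : ℝ) < (q h : ℝ) * ∑ a ∈ L, (q a : ℝ) + (q b : ℝ) * (((B b).card : ℝ) + 1))
    (htb : 1 - (q b : ℝ) ≤ t) (htL : 1 - (q h : ℝ) * ((∑ a ∈ L, (q a : ℝ)) / L.card) ≤ t) :
    (prodBernoulli q).real {ω' : Set (Fin n) |
      ((L ∪ ({b} : Finset (Fin n)).biUnion fun b' => insert b' (B b')).filter
        fun a => a = o ∨ ∀ i, i ≤ depth a → par^[i] a ∈ ω').card ≤ j} ≤ t := by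
  set μ := prodBernoulli q with hμ
  set U : ℝ := ∑ a ∈ L, (q a : ℝ) with hU
  set G : ℝ := (q h : ℝ) with hG
  have hG1 : G ≤ 1 := (q h).2.2
  have hL0' : 0 < L.card := Finset.card_pos.2 hL0
  have hLc : (0 : ℝ) < L.card := by exact_mod_cast hL0'
  -- degenerate cases: `U = 0` or `q h = 0` give `t ≥ 1`
  have hU0 : 0 ≤ U := Finset.sum_nonneg fun a _ => (q a).2.1
  rcases eq_or_lt_of_le hU0 with hUz | hUpos
  · have : 1 ≤ t := by rw [← hUz] at htL; simpa using htL
    exact measureReal_le_one.trans this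
  rcases eq_or_lt_of_le (q h).2.1 with hG0 | hGpos
  · have hG0' : G = 0 := by rw [hG]; exact hG0.symm
    have : 1 ≤ t := by rw [hG0', zero_mul, sub_zero] at htL; exact htL
    exact measureReal_le_one.trans this
  have hGpos' : 0 < G := hGpos
  -- `τ := min(U/|L|, q b / G)`
  set τ : ℝ := min (U / L.card) ((q b : ℝ) / G) with hτdef
  have hτU : τ ≤ U / L.card := min_le_left _ _
  have hτK : ∀ y ∈ ({b} : Finset (Fin n)), G * τ ≤ (q y : ℝ) := by
    intro y hy
    rw [Finset.mem_singleton] at hy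
    subst hy
    calc G * τ ≤ G * ((q y : ℝ) / G) := mul_le_mul_of_nonneg_left (min_le_right _ _) hGpos'.le
      _ = (q y : ℝ) := by field_simp
  have hτt : 1 - G * τ ≤ t := by
    rcases le_total (U / L.card) ((q b : ℝ) / G) with hc | hc
    · rw [hτdef, min_eq_left hc]; exact htL
    · rw [hτdef, min_eq_right hc]
      have : G * ((q b : ℝ) / G) = (q b : ℝ) := by field_simp
      rw [this]; exact htb
  -- the hub law: `P(X = b')`, monotone below its mean `U`
  set P : ℕ → ℝ := fun b' => μ.real {ω : Set (Fin n) | (L.filter fun x => x ∈ ω).card = b'} with hPdef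
  have hp0 : ∀ b', 0 ≤ P b' := fun b' => measureReal_nonneg
  have hsum : ∑ b' ∈ Finset.range (L.card + 1), P b' = 1 := pb_levels_sum_one q L
  have hmean : ∑ b' ∈ Finset.range (L.card + 1), (b' : ℝ) * P b' = U := pb_mean q L
  have hmono : ∀ b' : ℕ, 1 ≤ b' → (b' : ℝ) ≤ U → P (b' - 1) ≤ P b' := by
    intro b' hb1 hbU
    have := pb_pmf_mono_succ q L (b' - 1) (by
      have : (((b' - 1 : ℕ) : ℝ) + 1) = b' := by rw [Nat.cast_sub hb1]; push_cast; ring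
      rw [this]; exact hbU)
    have e : b' - 1 + 1 = b' := by omega
    rw [e] at this
    exact this
  -- the mean hypothesis in the conjecture's shape
  have hEN' : (2 * j : ℝ) < (∑ y ∈ ({b} : Finset (Fin n)), (((B y).card + 1 : ℕ) : ℝ) * (q y : ℝ)) + G * U := by
    rw [Finset.sum_singleton]
    push_cast
    rw [hG, hU]; linarith
  have hmain := hubBlocksProfileIneq_mono_singleton q b (fun b' => (B b').card + 1) L.card P U G τ j hp0 hsum hmean hUpos hmono
    hGpos' hG1 hEN' hτU hτK
  -- feed the profile bound to the unconditional reduction (with `K = {b}`)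
  have hbound := farTree_hubBlocks_of_profile q o h L {b} B depth par j τ
    (fun b' hb' => by rw [Finset.mem_singleton] at hb'; subst hb'; exact hK) hL
    (fun b' hb' => by rw [Finset.mem_singleton] at hb'; subst hb'; exact hB) hhL
    (by rw [Finset.mem_singleton]; exact hhb)
    (Finset.disjoint_singleton_right.2 hbL)
    (fun b' hb' => by rw [Finset.mem_singleton] at hb'; subst hb'; exact hLB)
    (fun b' hb' b'' hb'' => by
      rw [Finset.mem_singleton] at hb' hb''; subst hb'; subst hb''; exact hbB)
    (fun b' hb' b'' hb'' hne => by
      rw [Finset.mem_singleton] at hb' hb''; subst hb'; subst hb''; exact absurd rfl hne)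
    (fun b' hb' => by rw [Finset.mem_singleton] at hb'; subst hb'; exact hqB) hGpos' hmain
  exact hbound.trans hτt

end Quant

end Summit.CriticalPhenomena.PercolationContinuityZ3.Theorems
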